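import Mathlib
import HarnessLib
import Summits.FinalStateConjecture.Statement
import Summits.FinalStateConjecture.FinalStateConjecture.Theses.PhotonSphereChannels
import Literature.Geometry.Lorentzian.RadiatedEnergy
import Literature.Geometry.Lorentzian.EventHorizonArea
import Literature.Geometry.Lorentzian.ReggeWheelerChannels
import Literature.Geometry.Lorentzian.ReggeWheelerTortoise

/-!
# Sketch — first lemmas of the crux idea cards for
`PhotonSphereChannels.ChannelsResolveTameDevelopments` (item stmt-FinalStateConjecture-10046),
ideator 2, round 1.

Nothing here is proved; each `def … : Prop` is the first checkable statement of one card and must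
only elaborate (`lean check` rc 0, no sorry).
-/

noncomputable section

namespace Summit.FinalStateConjecture.FinalStateConjecture.Cruxes.ChannelsResolveTameDevelopments.Ideas

open Literature.Geometry.Lorentzian Filter Topology Set MeasureTheory
open scoped Manifold ContDiff ENNReal

/-! ## Card `first-law-pinching` -/

/-- **First-law pinching (Schwarzschild-final, one hole, rest frame; the card's K-level lemma in
its simplest typed instance).**  For every final mass `M_f > 0` and near-zone radius `R` there are
`η, C, p > 0` such that: for every admissible datum, every MGHD `𝒟`, every future Bondi foliation `𝓕`
with final Bondi mass `M_f`, every advanced-time foliation `A` of the event horizon (relative to a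
far region `U`) whose areas tend to `16π M_f²`, and every late chart `Ψ` from the Schwarzschild
background `Kerr.background M_f 0` whose truncated slabs `{t* = τ, r ≤ R}` lie to the causal future
of the cone `C_{u(τ)}` of `𝓕` and of the horizon cut `S_{v(τ)}` of `A` (cut bookkeeping `u, v`),
ONE-TIME `C¹`-closeness `dev(τ₁) ≤ η` implies, for all later chart times, the PINCHING INEQUALITY
`dev(τ)^p ≤ C · ([M_B(u(τ)) − M_f] + (κ_f/8π)·[A_f − A(v(τ))])` with `κ_f/8π = 1/(32π M_f)`,
`A_f = 16π M_f²`: the exactly monotone two-boundary budget (Bondi mass still to be radiated plus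
first-law-weighted horizon area still to be gained) dominates a power of the `C¹` deviation from
the final Schwarzschild on every later near-zone slab (in the degenerate energy norm the power is
`2`; the sup-norm power `p` absorbs the Gagliardo–Nirenberg interpolation against the uniform `C³`
bound of hypothesis (ii)).  Informal content: second variation of the first law
(Hollands–Wald, CMP 321 (2013), Prop. 1, §2.3: `ℰ = δ²M − Σ Ω δ²J − (κ/8π) δ²A`) on hyperboloidal
slabs + coercivity of the canonical energy modulo gauge ⊕ linearised Kerr (Moncrief/Masaood on
Schwarzschild) + tame cubic remainder.  The rotating version replaces `Kerr.background M_f 0` by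
`boostedKerrBackground Λ c M_f a_f`, `1/(32π M_f)` by `κ(M_f,a_f)/8π`, `16π M_f²` by
`8π M_f (M_f + √(M_f² − a_f²))` and carries the angular-momentum exchange term `Ω_f · ΔJ` (card,
§Barriers). -/
def FirstLawPinching : Prop :=
  ∀ (Mf R : ℝ), 0 < Mf → 0 < R →
    ∃ η C p : ℝ, 0 < η ∧ 0 < C ∧ 0 < p ∧
      ∀ (X : Type) [TopologicalSpace X] [ChartedSpace E3 X] [IsManifold (𝓡 3) ∞ X] [T2Space X]
        [SecondCountableTopology X] [ConnectedSpace X],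
      ∀ D ∈ admissibleVacuumData X, ∀ 𝒟 : VacuumCauchyDevelopment D, 𝒟.IsMaximal →
        ∀ [𝒟.metric.HasLeviCivita],
        ∀ (𝓕 : 𝒟.toCauchyDevelopment.FutureBondiFoliation) (U : Set 𝒟.carrier)
          (A : EventHorizonArea 𝒟.toCauchyDevelopment U)
          (Ψ : (Kerr.background Mf 0).domain → 𝒟.carrier) (τ₀ : ℝ) (u v : ℝ → ℝ),
          𝒟.toSpacetime.IsLateChart (Kerr.background Mf 0) Set.univ τ₀ Ψ →
          (∀ τ, Ψ '' (Kerr.background Mf 0).truncTimeSlab R τ ⊆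
              𝒟.metric.causalFuture 𝒟.timeOrientation
                (𝒟.metric.futureNullConeBoundary 𝒟.timeOrientation 𝒟.embed (𝓕.B (u τ)))) →
          (∀ τ, Ψ '' (Kerr.background Mf 0).truncTimeSlab R τ ⊆
              𝒟.metric.causalFuture 𝒟.timeOrientation
                (range (A.leaf (v τ)) ∩ 𝒟.toCauchyDevelopment.eventHorizon U)) →
          𝓕.HasFinalBondiMass Mf →
          Tendsto A.horizonArea atTop (𝓝 (ENNReal.ofReal (16 * Real.pi * Mf ^ 2))) →
          ∀ τ₁, τ₀ < τ₁ →
            𝒟.toSpacetime.truncDeviationCk (Kerr.background Mf 0) Ψ 1 R τ₁ ≤ ENNReal.ofReal η →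
            ∀ τ, τ₁ ≤ τ →
              𝒟.toSpacetime.truncDeviationCk (Kerr.background Mf 0) Ψ 1 R τ ^ p ≤
                ENNReal.ofReal C *
                  (ENNReal.ofReal (𝓕.bondiMass (u τ) - Mf) +
                    ENNReal.ofReal (1 / (32 * Real.pi * Mf)) *
                      (ENNReal.ofReal (16 * Real.pi * Mf ^ 2) - A.horizonArea (v τ)))

/-- The budget of `FirstLawPinching` is antitone and tends to zero — the elementary half of the
pinching (Bondi mass loss + area theorem + the two limits); stated for an abstract pair of
monotone bookkeeping functions so that it is provable now. -/
def TwoBudgetsVanish : Prop :=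
  ∀ (mB : ℝ → ℝ) (aH : ℝ → ℝ≥0∞) (Mf : ℝ) (Af : ℝ≥0∞) (κ : ℝ),
    Antitone mB → Monotone aH → Tendsto mB atTop (𝓝 Mf) → Tendsto aH atTop (𝓝 Af) → Af ≠ ⊤ →
      0 ≤ κ →
      Antitone (fun τ ↦ ENNReal.ofReal (mB τ - Mf) + ENNReal.ofReal κ * (Af - aH τ)) ∧
        Tendsto (fun τ ↦ ENNReal.ofReal (mB τ - Mf) + ENNReal.ofReal κ * (Af - aH τ)) atTop (𝓝 0)

/-- The bootstrap skeleton behind "pinching ⇒ capture": a continuous deviation `e ≥ 0`, pinched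
by `c e² − C e³ ≤ b` against an antitone budget `b → 0` while `e ≤ η₀`, and small at one time,
tends to zero.  Pure real analysis (provable now); it is how `FirstLawPinching` is consumed. -/
def PinchingBootstrap : Prop :=
  ∀ (e b : ℝ → ℝ) (c C η₀ τ₁ : ℝ), 0 < c → 0 ≤ C → 0 < η₀ → C * η₀ ≤ c / 2 →
    Continuous e → (∀ τ, 0 ≤ e τ) → Antitone b → Tendsto b atTop (𝓝 0) →
    (∀ τ, τ₁ ≤ τ → e τ ≤ η₀ → c * e τ ^ 2 - C * e τ ^ 3 ≤ b τ) →
    e τ₁ < η₀ → b τ₁ < c / 2 * η₀ ^ 2 →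
      Tendsto e atTop (𝓝 0)

end Summit.FinalStateConjecture.FinalStateConjecture.Cruxes.ChannelsResolveTameDevelopments.Ideas

end
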